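import Summits.SmoothPoincare4.SmoothPoincare4.Theorems.SullivanDualWitnessChargeCapDefs

/-!
# Stub `stub_leafFloc` of skeleton v15 (crux `WitnessCharge`, stmt-SmoothPoincare4-7824, line
`Sketch`, lead c8) — the puncture parametrisation of one leaf: set-theoretic part

Registered helper `helper_leafFloc_param`. Fix cap data `D : CapData S p J ε'` and ONE leaf of
the local family of embedded `JX`-spheres of the cap model, given by its two charts
`Ua, Va : ℂ → D.X` (`Va z = Ua z⁻¹` for `z ≠ 0`, `Ua` injective, `Va 0 ∉ range Ua`) together with
the conclusions of the intercept chart (stub `stub_interceptChart`) for this leaf: on the `V`-disc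
`‖w‖ < 1/2` the leaf lies in the cap chart domain, it meets the added line `E = range D.capPt` on
`‖w‖ ≤ 1/2` exactly at `w = w₀` (`‖w₀‖ < 1/4`), and `Ua (‖z‖ ≤ 2) ⊆ range D.ι`.

The PUNCTURE PARAMETRISATION of the leaf minus its point `Va w₀` on `E` is
`P ξ' = Va (w₀ + ξ'⁻¹)` (`ξ' ≠ 0`), `P 0 = Ua 0`. This file proves its elementary properties:

* near `ξ' = 0` (precisely where `1 + w₀ ξ' ≠ 0`) `P ξ' = Ua (ξ' / (1 + w₀ ξ'))` — so `P` is given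
  by two smooth formulas on an open cover of `ℂ`;
* every value of `P` lies in `range D.ι = X ∖ E`;
* `range P = (range Ua ∪ {Va 0}) ∩ range D.ι` (the leaf minus its point on `E`);
* `P` is injective;
* for `‖w‖ < 1/2`, `w ≠ w₀`: the cap coordinate `t = (D.capCoord (Va w)).1` is nonzero and
  `Va w = D.ι x` with `x` in the punctured `ε'`-chart-ball and flat coordinates
  `Ycoord p x = (t⁻¹, (D.capCoord (Va w)).2)` (the gluing `(t, σ) = (1/z, w)`).
-/

noncomputable section

set_option linter.dupNamespace false

open scoped Manifold ContDiff Topology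
open Set Filter Literature.Geometry.Symplectic Literature.Topology.FourManifolds

namespace Summit.SmoothPoincare4.SmoothPoincare4.Theorems.WitnessCharge.PencilIncompleteness

variable {S : HomotopySphere 4} {p : S.carrier}
  {J : ∀ x : punctured p, TangentSpace (𝓡 4) x →L[ℝ] TangentSpace (𝓡 4) x} {ε' : ℝ}

/-- The two charts of a leaf glue to an injective map: `Va` is injective if `Ua` is,
`Va z = Ua z⁻¹` for `z ≠ 0` and `Va 0 ∉ range Ua`. -/
theorem leafFloc_injective_V {X : Type} {Ua Va : ℂ → X} (hUV : ∀ z : ℂ, z ≠ 0 → Va z = Ua z⁻¹)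
    (hUinj : Function.Injective Ua) (hV0 : Va 0 ∉ range Ua) : Function.Injective Va := by
  intro z₁ z₂ h
  by_cases h₁ : z₁ = 0
  · by_cases h₂ : z₂ = 0
    · rw [h₁, h₂]
    · rw [h₁, hUV z₂ h₂] at h
      exact absurd ⟨_, h.symm⟩ hV0
  · by_cases h₂ : z₂ = 0
    · rw [h₂, hUV z₁ h₁] at h
      exact absurd ⟨_, h⟩ hV0
    · rw [hUV z₁ h₁, hUV z₂ h₂] at h
      exact inv_injective (hUinj h)

/-- In the cap chart domain a point off the added line `E` is a point of `Σ ∖ p` in the punctured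
`ε'`-chart-ball with flat coordinates `(z, w) = (t⁻¹, σ)`, `(t, σ) = D.capCoord y`, `t ≠ 0`. -/
theorem CapData.leafFloc_exists_eq_ι_of_mem_capDom (D : CapData S p J ε') {y : D.X}
    (hy : y ∈ D.capInv '' {q : ℂ × ℂ | ‖q.1‖ < D.ρ}) (hE : y ∉ range D.capPt) :
    (D.capCoord y).1 ≠ 0 ∧ ∃ x : punctured p, y = D.ι x ∧ InPuncturedChartBall p ε' x ∧
      Ycoord p x = (((D.capCoord y).1)⁻¹, (D.capCoord y).2) := by
  obtain ⟨q, hq, rfl⟩ := hy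
  have hcc : D.capCoord (D.capInv q) = q := D.capCoord_capInv q hq
  rw [hcc]
  have hq1 : q.1 ≠ 0 := by
    intro h0
    apply hE
    refine ⟨q.2, ?_⟩
    rw [show q = (0, q.2) from Prod.ext h0 rfl, D.capInv_zero]
  obtain ⟨x, hx, hball, hY⟩ := D.capInv_flat q hq hq1
  exact ⟨hq1, x, hx, hball, hY⟩

/-- **Registered helper `helper_leafFloc_param` — the puncture parametrisation of a leaf minus
its point on the added line (set-theoretic part).** See the module docstring: the `U`-formula
`P ξ' = Ua (ξ' / (1 + w₀ ξ'))` where `1 + w₀ ξ' ≠ 0`, `range P ⊆ range D.ι`,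
`range P = (range Ua ∪ {Va 0}) ∩ range D.ι`, injectivity of `P`, and the cap/flat coordinates of
the points `Va w`, `‖w‖ < 1/2`, `w ≠ w₀`. -/
theorem helper_leafFloc_param :
    ∀ (S : HomotopySphere 4) (p : S.carrier)
      (J : ∀ x : punctured p, TangentSpace (𝓡 4) x →L[ℝ] TangentSpace (𝓡 4) x) (ε' : ℝ)
      (D : CapData S p J ε') (Ua Va : ℂ → D.X) (w₀ : ℂ) (P : ℂ → D.X),
      (∀ z : ℂ, z ≠ 0 → Va z = Ua z⁻¹) → Function.Injective Ua → Va 0 ∉ range Ua →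
      (∀ w : ℂ, ‖w‖ < 2⁻¹ → Va w ∈ D.capInv '' {q : ℂ × ℂ | ‖q.1‖ < D.ρ}) →
      (∀ w : ℂ, ‖w‖ ≤ 2⁻¹ → (Va w ∈ range D.capPt ↔ w = w₀)) →
      (∀ z : ℂ, ‖z‖ ≤ 2 → Ua z ∈ range D.ι) →
      ‖w₀‖ < 4⁻¹ →
      (∀ ξ' : ℂ, ξ' ≠ 0 → P ξ' = Va (w₀ + ξ'⁻¹)) → P 0 = Ua 0 →
      (∀ ξ' : ℂ, 1 + w₀ * ξ' ≠ 0 → P ξ' = Ua (ξ' / (1 + w₀ * ξ'))) ∧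
      (∀ ξ' : ℂ, P ξ' ∈ range D.ι) ∧
      range P = (range Ua ∪ {Va 0}) ∩ range D.ι ∧
      Function.Injective P ∧
      (∀ w : ℂ, ‖w‖ < 2⁻¹ → w ≠ w₀ → (D.capCoord (Va w)).1 ≠ 0 ∧
        ∃ x : punctured p, Va w = D.ι x ∧ InPuncturedChartBall p ε' x ∧
          Ycoord p x = (((D.capCoord (Va w)).1)⁻¹, (D.capCoord (Va w)).2)) := by
  intro S p J ε' D Ua Va w₀ P hUV hUinj hV0 hcap hE hUι hw₀ hPne hP0
  have hVinj : Function.Injective Va := leafFloc_injective_V hUV hUinj hV0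
  have hw₀' : ‖w₀‖ ≤ 2⁻¹ := hw₀.le.trans (by norm_num)
  -- the point of the leaf on `E`
  have hVw₀E : Va w₀ ∈ range D.capPt := (hE w₀ hw₀').2 rfl
  have hVw₀ι : Va w₀ ∉ range D.ι := by
    rintro ⟨x, hx⟩
    obtain ⟨σ, hσ⟩ := hVw₀E
    exact D.ι_ne_capPt x σ (hx.trans hσ.symm)
  -- (v) cap coordinates on the `V`-disc off `w₀`
  have hflat : ∀ w : ℂ, ‖w‖ < 2⁻¹ → w ≠ w₀ → (D.capCoord (Va w)).1 ≠ 0 ∧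
      ∃ x : punctured p, Va w = D.ι x ∧ InPuncturedChartBall p ε' x ∧
        Ycoord p x = (((D.capCoord (Va w)).1)⁻¹, (D.capCoord (Va w)).2) := by
    intro w hw hne
    refine D.leafFloc_exists_eq_ι_of_mem_capDom (hcap w hw) fun hmem => hne ((hE w hw.le).1 hmem)
  -- (i') `Va w ∈ range ι` for every `w ≠ w₀`
  have hVι : ∀ w : ℂ, w ≠ w₀ → Va w ∈ range D.ι := by
    intro w hne
    by_cases hw : ‖w‖ < 2⁻¹
    · obtain ⟨-, x, hx, -, -⟩ := hflat w hw hne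
      exact ⟨x, hx.symm⟩
    · have hw' : 2⁻¹ ≤ ‖w‖ := not_lt.1 hw
      have hw0 : w ≠ 0 := by
        intro h0; rw [h0, norm_zero] at hw'; norm_num at hw'
      rw [hUV w hw0]
      refine hUι _ ?_
      rw [norm_inv]
      calc ‖w‖⁻¹ ≤ (2⁻¹ : ℝ)⁻¹ := inv_anti₀ (by norm_num) hw'
        _ = 2 := by norm_num
  -- (iv) the `U`-formula near `ξ' = 0`
  have hPU : ∀ ξ' : ℂ, 1 + w₀ * ξ' ≠ 0 → P ξ' = Ua (ξ' / (1 + w₀ * ξ')) := by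
    intro ξ' hξ'
    by_cases h0 : ξ' = 0
    · rw [h0, hP0, zero_div]
    · have hne : w₀ + ξ'⁻¹ ≠ 0 := by
        intro h
        apply hξ'
        have : (w₀ + ξ'⁻¹) * ξ' = 0 := by rw [h, zero_mul]
        rw [add_mul, inv_mul_cancel₀ h0] at this
        linear_combination this
      rw [hPne ξ' h0, hUV _ hne]
      congr 1
      field_simp
      rw [add_comm (w₀ * ξ') 1, div_self hξ']
  -- (i) every value of `P` is in `range ι`
  have hPι : ∀ ξ' : ℂ, P ξ' ∈ range D.ι := by
    intro ξ'
    by_cases h0 : ξ' = 0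
    · rw [h0, hP0]
      exact hUι 0 (by norm_num)
    · rw [hPne ξ' h0]
      refine hVι _ fun h => h0 ?_
      have : ξ'⁻¹ = 0 := by linear_combination h
      exact inv_eq_zero.1 this
  -- (ii) the range of `P`
  have hrange : range P = (range Ua ∪ {Va 0}) ∩ range D.ι := by
    apply Subset.antisymm
    · rintro _ ⟨ξ', rfl⟩
      refine ⟨?_, hPι ξ'⟩
      by_cases h0 : ξ' = 0
      · rw [h0, hP0]; exact Or.inl ⟨0, rfl⟩
      · rw [hPne ξ' h0]
        by_cases hw : w₀ + ξ'⁻¹ = 0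
        · rw [hw]; exact Or.inr rfl
        · rw [hUV _ hw]; exact Or.inl ⟨_, rfl⟩
    · rintro y ⟨hy, hyι⟩
      rcases hy with ⟨z, rfl⟩ | hy
      · -- `y = Ua z`
        by_cases hz : z = 0
        · exact ⟨0, by rw [hP0, hz]⟩
        · have hzw : z⁻¹ ≠ w₀ := by
            intro h
            apply hVw₀ι
            rw [← h, hUV _ (inv_ne_zero hz), inv_inv]
            exact hyι
          have hξ : (z⁻¹ - w₀)⁻¹ ≠ 0 := inv_ne_zero (sub_ne_zero.2 hzw)
          refine ⟨(z⁻¹ - w₀)⁻¹, ?_⟩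
          rw [hPne _ hξ, inv_inv, add_sub_cancel, hUV _ (inv_ne_zero hz), inv_inv]
      · -- `y = Va 0`
        rw [mem_singleton_iff] at hy
        subst hy
        have hw0 : w₀ ≠ 0 := by
          intro h; apply hVw₀ι; rw [h]; exact hyι
        refine ⟨(-w₀)⁻¹, ?_⟩
        rw [hPne _ (inv_ne_zero (neg_ne_zero.2 hw0)), inv_inv, add_neg_cancel]
  -- (iii) injectivity of `P`
  have hPinj : Function.Injective P := by
    intro ξ₁ ξ₂ h
    by_cases h₁ : ξ₁ = 0
    · by_cases h₂ : ξ₂ = 0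
      · rw [h₁, h₂]
      · exfalso
        rw [h₁, hP0, hPne ξ₂ h₂] at h
        by_cases hw : w₀ + ξ₂⁻¹ = 0
        · rw [hw] at h; exact hV0 ⟨0, h⟩
        · rw [hUV _ hw] at h
          exact hw (inv_eq_zero.1 (hUinj h).symm)
    · by_cases h₂ : ξ₂ = 0
      · exfalso
        rw [h₂, hP0, hPne ξ₁ h₁] at h
        by_cases hw : w₀ + ξ₁⁻¹ = 0
        · rw [hw] at h; exact hV0 ⟨0, h.symm⟩
        · rw [hUV _ hw] at h
          exact hw (inv_eq_zero.1 (hUinj h))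
      · rw [hPne ξ₁ h₁, hPne ξ₂ h₂] at h
        exact inv_injective (add_left_cancel (hVinj h))
  exact ⟨hPU, hPι, hrange, hPinj, hflat⟩

end Summit.SmoothPoincare4.SmoothPoincare4.Theorems.WitnessCharge.PencilIncompleteness
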